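import Summits.NavierStokesRegularity.NavierStokesRegularity.Theorems.WakeRatchetRatchetStarvationBlock
import Summits.NavierStokesRegularity.NavierStokesRegularity.Theorems.WakeRatchetBlockRateGlue

/-!
# Route `WakeRatchet` — the BLOCK-REPAIRED deciding chain, end to end (helper for ⟨stmt-NavierStokesRegularity-25646⟩; repair census)

`WakeRatchet.closes` derives the rung leaf `TaoLadderRungTwoBreak.Target` from the PER-SHELL rate ratchet `TailRateRatchet` (= ⟨25646⟩ ∧ ⟨25647⟩
by the landed glue ⟨25648⟩), `TailEnvelopeFinite`, `RatchetStarvation` and `EternalRigidityViscBddOne`.  Instrument O-2 (RESULT-E-g10-2/3 on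
⟨25646⟩) suspects the per-shell rate cruxes MISSTATED per shell, with BLOCK forms as the repair (planner LINE g11-2; not filed as items).
This file composes the landed def-free block bookkeeping (`WakeRatchetBlockRate.blockRateRatchet_of_split`, p820422;
`RatchetStarvationBlock.noRobustBlowupBelow_of_blockRateRatchet`, p820325) into ONE theorem with the shape of `WakeRatchet.closes`:

* `target_of_blockChildren` — the BLOCK form of ⟨25646⟩ (written out, every `R ≥ 1`) ∧ the BLOCK form of ⟨25647⟩ (written out) ∧ the route
  item `EternalRigidityViscBddOne` ⟹ `TaoLadderRungTwoBreak.Target`.  (`TailEnvelopeFinite` and block starvation are landed theorems, so they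
  are not hypotheses.)
So a block re-typing of ⟨25584⟩/⟨25646⟩/⟨25647⟩ by the tenure leaves EXACTLY the two block children as open analytic content; everything below
them is kernel-checked here.  HONEST LABEL: bookkeeping under hypotheses that the tree does NOT supply; no registered stub or item is closed; the
block statements are NOT route items; MODEL lattice only (Tao 2016 §4); `Target` is the MODEL rung TL-M2Break, not the summit, and nothing here
bears on the Navier–Stokes equations.
[cite: Tao2016AveragedNS, §4 Thm. 4.2 (statement shape), Lemma 4.1 (4.8)–(4.10), §6.4; elementary]
-/

noncomputable section

set_option linter.dupNamespace false

open Filter Topology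
open Literature.Analysis.FluidPDE.TaoCascade

namespace Summit.NavierStokesRegularity.NavierStokesRegularity.Theorems

namespace RatchetStarvationBlock

/-- **Block children ⇒ rung leaf.**  If for every `R ≥ 1` the BLOCK inviscid rate ratchet (block form of ⟨25646⟩) and the BLOCK viscous rate
ratchet (block form of ⟨25647⟩, `ν̂ > 0`) hold at spread `R`, and the extraction crux `EternalRigidityViscBddOne` holds, then
`TaoLadderRungTwoBreak.Target`: split glue (p820422) → block starvation (p820325) → `noRobustBlowupBelow_of_eternalViscBdd`, as in
`WakeRatchet.closes`.  Hypotheses NOT supplied by the tree.  MODEL lattice only.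
[cite: Tao2016AveragedNS, §4 Thm. 4.2 (statement shape), §6.4; elementary] -/
theorem target_of_blockChildren
    (hA : ∀ R : ℝ, 1 ≤ R → ∃ a : ℝ, 1 < a ∧ ∃ εs : ℝ, 0 < εs ∧ ∀ ε₀ : ℝ, 0 < ε₀ → ε₀ ≤ εs →
      ∃ b : ℕ, 1 ≤ b ∧
      ∀ α : Fin 4 → Fin 4 → Fin 4 → ℤ × ℤ × ℤ → ℝ, InTableClass R α →
      ∀ W : ℤ → ℝ → Em 4, IsEternal ε₀ α W → UniformBound W →
      ∀ (n : ℤ) (M : ℝ), (∀ σ : ℝ, ∑' k : ℕ, physEnergy ε₀ W (n + k) σ ≤ M) →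
        ∀ σ : ℝ, ∑' k : ℕ, physEnergy ε₀ W (n + b + k) σ ≤ (1 + ε₀) ^ (-(a * b)) * M)
    (hB : ∀ R : ℝ, 1 ≤ R → ∃ a : ℝ, 1 < a ∧ ∃ εs : ℝ, 0 < εs ∧ ∀ ε₀ : ℝ, 0 < ε₀ → ε₀ ≤ εs →
      ∃ b : ℕ, 1 ≤ b ∧
      ∀ α : Fin 4 → Fin 4 → Fin 4 → ℤ × ℤ × ℤ → ℝ, InTableClass R α →
      ∀ (νh : ℝ) (W : ℤ → ℝ → Em 4), 0 < νh → IsEternalVisc ε₀ νh α W → UniformBound W →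
      ∀ (n : ℤ) (M : ℝ), (∀ σ : ℝ, ∑' k : ℕ, physEnergy ε₀ W (n + k) σ ≤ M) →
        ∀ σ : ℝ, ∑' k : ℕ, physEnergy ε₀ W (n + b + k) σ ≤ (1 + ε₀) ^ (-(a * b)) * M)
    (h₄ : Summit.NavierStokesRegularity.NavierStokesRegularity.Theses.WakeRatchet.EternalRigidityViscBddOne) :
    Summit.NavierStokesRegularity.NavierStokesRegularity.Theses.TaoLadderRungTwoBreak.Target := by
  intro R hR
  exact noRobustBlowupBelow_of_blockRateRatchet (WakeRatchetBlockRate.blockRateRatchet_of_split (hA R hR) (hB R hR)) (h₄ R hR)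

end RatchetStarvationBlock

end Summit.NavierStokesRegularity.NavierStokesRegularity.Theorems

end
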